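import Literature.Analysis.Complex.LogDerivZerosDisc
import Literature.Analysis.Complex.JensenPolynomialSector
import Mathlib.Analysis.Complex.Liouville
import HarnessLib

/-!
# The far factor of an entire function on a disc: a slowly varying logarithmic derivative (proved)

Trunk `Literature/Analysis/Complex`, grouping namespace `Literature.Analysis.Complex.KimLee` (support
for the genus-one case of Kim–Lee 2021, Thm. 1, `JensenPolynomialSectorGenusOne.lean`).

Let `F` be entire with `F(0) ≠ 0`, and for a radius `R` write (Titchmarsh, §3.9, Lemma α; the
tree's `Literature.Analysis.Complex.exists_eq_prod_pow_sub_mul`) `F = P · G` on `|z| ≤ R`, where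
`P(z) = ∏_{|u| ≤ R/2} (z − u)^{m(u)}` is the zero polynomial of the disc `|z| ≤ R/2` (Mathlib's
`MeromorphicOn.divisor`) and the *far factor* `G` is holomorphic on `|z| ≤ R` and zero-free on
`|z| ≤ R/2`. This file quantifies that `G` is "almost an exponential `e^{βz}`" near the origin:

* `norm_logDeriv_farFactor_le_of_ne_zero`: on `|z| ≤ R/8`, off the zeros of `F`,
  `|G'/G(z)| ≤ (16/R)(log(B/|F(0)|) + N log 2 + 1)` (`B = sup_{|z|≤R} |F|`, `N` = number of zeros in
  `|z| ≤ R/2`) — the tree's disc form of Titchmarsh's lemma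
  (`Literature.Analysis.Complex.norm_logDeriv_sub_sum_le`) plus `F'/F = P'/P + G'/G`;
* `norm_le_of_forall_ne_zero` removes the proviso "off the zeros" (isolated zeros, continuity);
* `norm_deriv_logDeriv_le` (Cauchy) and `norm_logDeriv_sub_logDeriv_zero_le` (mean value):
  `|G'/G(z) − G'/G(0)| ≤ (16 ε/R)|z|` on `|z| ≤ R/16`;
* `exists_exp_repr_farFactor`: for `R ≥ 32`, on `|z| < 2`,
  `G(z) = G(0) e^{βz} e^{φ(z)}` with `β = G'/G(0)` and `|φ(z)| ≤ (64 ε/R)|z|`.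

With `B = C e^{R^ρ}` and Jensen's bound `N = O(R^ρ)` one has `ε = O(R^{ρ−1})`, so `64ε/R → 0` for
`ρ < 2`: this is how the genus-one Hadamard factor `e^{bz}` is recovered without any factorisation
theorem.

## References

* E. C. Titchmarsh, *The Theory of the Riemann Zeta-Function*, 2nd ed., §3.9 Lemma α (the tree's
  `LogDerivZerosDisc.lean`).
* Y.-O. Kim, J. Lee, *A note on the zeros of Jensen polynomials*, arXiv:2105.05386, proof of Thm. 1
  (the role of the genus-one Hadamard product).
-/

noncomputable section

open Complex Filter Metric Set Topology MeromorphicOn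

namespace Literature.Analysis.Complex.KimLee

open Literature.Analysis.Complex.HadamardGenusZero

variable {F : ℂ → ℂ}

/-! ### The zero data of the disc `|z| ≤ R/2` -/

/-- Points of the support of the divisor of the disc `|u| ≤ R₂` have positive multiplicity.
[folklore] -/
theorem toNat_divisor_pos (hF : Differentiable ℂ F) {R₂ : ℝ} {u : ℂ}
    (hu : u ∈ ((divisor F (closedBall (0 : ℂ) R₂)).finiteSupport
      (isCompact_closedBall 0 R₂)).toFinset) :
    0 < (divisor F (closedBall (0 : ℂ) R₂) u).toNat := by
  rw [Set.Finite.mem_toFinset, Function.mem_support] at hu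
  have hnn : 0 ≤ divisor F (closedBall (0 : ℂ) R₂) u :=
    (AnalyticOnNhd.divisor_nonneg (analyticOnNhd_of_entire hF _)) u
  rw [Int.lt_toNat, Nat.cast_zero]
  exact lt_of_le_of_ne hnn (Ne.symm hu)

/-- Points of the support lie in the disc. [folklore] -/
theorem norm_le_of_mem_support (F : ℂ → ℂ) {R₂ : ℝ} {u : ℂ}
    (hu : u ∈ ((divisor F (closedBall (0 : ℂ) R₂)).finiteSupport
      (isCompact_closedBall 0 R₂)).toFinset) : ‖u‖ ≤ R₂ := by
  rw [Set.Finite.mem_toFinset] at hu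
  exact mem_closedBall_zero_iff.1 ((divisor F (closedBall (0 : ℂ) R₂)).supportWithinDomain hu)

/-- The multiplicity as a complex number: `((D u).toNat : ℂ) = (D u : ℂ)`. [folklore] -/
theorem natCast_toNat_divisor (hF : Differentiable ℂ F) (R₂ : ℝ) (u : ℂ) :
    ((divisor F (closedBall (0 : ℂ) R₂) u).toNat : ℂ) = (divisor F (closedBall (0 : ℂ) R₂) u : ℂ) := by
  have hnn : 0 ≤ divisor F (closedBall (0 : ℂ) R₂) u :=
    (AnalyticOnNhd.divisor_nonneg (analyticOnNhd_of_entire hF _)) u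
  rw [← Int.cast_natCast, Int.toNat_of_nonneg hnn]

/-- The zero polynomial of the disc vanishes exactly on the support. [folklore] -/
theorem prod_pow_sub_eq_zero_iff (hF : Differentiable ℂ F) {R₂ : ℝ} {z : ℂ} :
    ∏ u ∈ ((divisor F (closedBall (0 : ℂ) R₂)).finiteSupport (isCompact_closedBall 0 R₂)).toFinset,
        (z - u) ^ (divisor F (closedBall (0 : ℂ) R₂) u).toNat = 0 ↔
      z ∈ ((divisor F (closedBall (0 : ℂ) R₂)).finiteSupport (isCompact_closedBall 0 R₂)).toFinset := by
  rw [Finset.prod_eq_zero_iff]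
  constructor
  · rintro ⟨u, hu, h⟩
    obtain rfl : z = u := sub_eq_zero.1 ((pow_eq_zero_iff (toNat_divisor_pos hF hu).ne').1 h)
    exact hu
  · intro hz
    exact ⟨z, hz, by rw [sub_self, zero_pow (toNat_divisor_pos hF hz).ne']⟩

/-! ### The logarithmic derivative of the far factor -/

/-- **Titchmarsh's lemma for the far factor.** Let `F` be entire with `F(0) ≠ 0`, `|F| ≤ B` on
`|z| ≤ R`, and `F = P · G` on `|z| ≤ R` with `P` the zero polynomial of `|z| ≤ R/2` and `G` holomorphic
on `|z| ≤ R`, zero-free on `|z| ≤ R/2` (`Literature.Analysis.Complex.exists_eq_prod_pow_sub_mul`). Then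
for `|z| ≤ R/8` with `F(z) ≠ 0`: `|G'/G(z)| ≤ (16/R)(log(B/|F(0)|) + N log 2 + 1)`, `N = Σ m(u)`
(the tree's `norm_logDeriv_sub_sum_le` with radii `R/8 < R/4 < R/2 < R`, and `F'/F = P'/P + G'/G`).
[cite: Titchmarsh1986, §3.9 Lemma α] -/
theorem norm_logDeriv_farFactor_le_of_ne_zero (hF : Differentiable ℂ F) (h0 : F 0 ≠ 0) {R B : ℝ}
    (hR : 0 < R) (hB : ∀ z ∈ closedBall (0 : ℂ) R, ‖F z‖ ≤ B) {G : ℂ → ℂ}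
    (hG : AnalyticOnNhd ℂ G (closedBall (0 : ℂ) R))
    (hFPG : ∀ z ∈ closedBall (0 : ℂ) R, F z =
      (∏ u ∈ ((divisor F (closedBall (0 : ℂ) (R / 2))).finiteSupport
          (isCompact_closedBall 0 (R / 2))).toFinset,
        (z - u) ^ (divisor F (closedBall (0 : ℂ) (R / 2)) u).toNat) * G z)
    {z : ℂ} (hz : z ∈ closedBall (0 : ℂ) (R / 8)) (hFz : F z ≠ 0) :
    ‖logDeriv G z‖ ≤ 16 / R * (Real.log (B / ‖F 0‖) +
      (∑ u ∈ ((divisor F (closedBall (0 : ℂ) (R / 2))).finiteSupport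
          (isCompact_closedBall 0 (R / 2))).toFinset,
        (divisor F (closedBall (0 : ℂ) (R / 2)) u : ℝ)) * Real.log 2 + 1) := by
  classical
  set D := divisor F (closedBall (0 : ℂ) (R / 2)) with hD
  set S := (D.finiteSupport (isCompact_closedBall 0 (R / 2))).toFinset with hS
  set P : ℂ → ℂ := fun w => ∏ u ∈ S, (w - u) ^ (D u).toNat with hP
  have key := norm_logDeriv_sub_sum_le (f := F) (c := 0) (r := R / 8) (r₁ := R / 4) (R₂ := R / 2)
    (R := R) (B := B) (by positivity) (by linarith) (by linarith) (by linarith)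
    (analyticOnNhd_of_entire hF _) h0 hB hz hFz
  -- `F z = P z * G z` near `z`, so `logDeriv F z = logDeriv P z + logDeriv G z`
  have hzR : z ∈ closedBall (0 : ℂ) R := closedBall_subset_closedBall (by linarith) hz
  have hzball : z ∈ ball (0 : ℂ) R := by
    rw [mem_closedBall, dist_zero_right] at hz
    rw [mem_ball, dist_zero_right]; linarith
  have hPG : F z = P z * G z := hFPG z hzR
  have hPz : P z ≠ 0 := fun h => hFz (by rw [hPG, h, zero_mul])
  have hGz : G z ≠ 0 := fun h => hFz (by rw [hPG, h, mul_zero])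
  have hev : F =ᶠ[𝓝 z] fun w => P w * G w := by
    filter_upwards [isOpen_ball.mem_nhds hzball] with w hw using hFPG w (ball_subset_closedBall hw)
  have hlogF : logDeriv F z = logDeriv (fun w => P w * G w) z := by
    rw [logDeriv_apply, logDeriv_apply, hev.deriv_eq, hev.eq_of_nhds]
  have hPdiff : DifferentiableAt ℂ P z := (differentiable_prod_pow_sub S _ ) z
  have hGdiff : DifferentiableAt ℂ G z := (hG z hzR).differentiableAt
  have hmul := logDeriv_mul z hPz hGz hPdiff hGdiff
  have hzS : ∀ a ∈ S, z ≠ a := by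
    intro a ha hza
    exact hPz ((prod_pow_sub_eq_zero_iff hF).2 (hza ▸ ha))
  have hlogP : logDeriv P z = ∑ u ∈ S, (D u : ℂ) / (z - u) := by
    rw [logDeriv_apply, hP, deriv_prod_pow_sub_div _ hzS]
    refine Finset.sum_congr rfl fun u _ => ?_
    rw [natCast_toNat_divisor hF]
  have hG_eq : logDeriv G z = logDeriv F z - ∑ u ∈ S, (D u : ℂ) / (z - u) := by
    rw [hlogF, hmul, hlogP]; ring
  rw [hG_eq]
  refine key.trans (le_of_eq ?_)
  have h1 : 2 * (R / 4) / ((R / 2 - R / 4) * (R / 4 - R / 8)) = 16 / R := by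
    field_simp; ring
  have h2 : Real.log (R / (R - R / 2)) = Real.log 2 := by
    congr 1; field_simp; ring
  rw [h1, h2]

/-- **Removing the proviso `F(z) ≠ 0`.** If `g` is continuous on `|z| ≤ r` and `|g(z)| ≤ ε` at the
points of the disc where the entire function `F` (`F(0) ≠ 0`) does not vanish, then `|g| ≤ ε` on the
whole disc (the zeros of `F` are isolated: approach a zero `z` along the radius `(1 − t) z`).
[folklore] -/
theorem norm_le_of_forall_ne_zero (hF : Differentiable ℂ F) (h0 : F 0 ≠ 0) {g : ℂ → ℂ} {r ε : ℝ}
    (hg : ContinuousOn g (closedBall (0 : ℂ) r))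
    (hb : ∀ z ∈ closedBall (0 : ℂ) r, F z ≠ 0 → ‖g z‖ ≤ ε) :
    ∀ z ∈ closedBall (0 : ℂ) r, ‖g z‖ ≤ ε := by
  intro z hz
  by_cases hFz : F z ≠ 0
  · exact hb z hz hFz
  push Not at hFz
  have hz0 : z ≠ 0 := fun h => h0 (h ▸ hFz)
  set A : Set ℂ := {w ∈ closedBall (0 : ℂ) r | F w ≠ 0} with hA
  -- `F` is not identically zero near `z`
  have hev : ∀ᶠ w in 𝓝[≠] z, F w ≠ 0 := by
    rcases (hF.analyticAt z).eventually_eq_zero_or_eventually_ne_zero with h | h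
    · exact absurd (analyticOrderAt_eq_top.2 h) (analyticOrderAt_ne_top hF h0 z)
    · exact h
  -- the radius `t ↦ (1 - t) z`
  set u : ℝ → ℂ := fun t => ((1 - t : ℝ) : ℂ) * z with hu
  have hu_tend : Tendsto u (𝓝[>] 0) (𝓝 z) := by
    have hc : Continuous u := by
      simp only [hu]; exact (continuous_ofReal.comp (continuous_const.sub continuous_id)).mul
        continuous_const
    have := hc.continuousAt.tendsto (x := 0)
    simp only [hu, sub_zero, ofReal_one, one_mul] at this
    exact this.mono_left nhdsWithin_le_nhds
  have hu_ne : ∀ᶠ t in 𝓝[>] (0 : ℝ), u t ∈ ({z}ᶜ : Set ℂ) := by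
    filter_upwards [self_mem_nhdsWithin] with t ht
    simp only [mem_compl_iff, mem_singleton_iff, hu]
    intro h
    have : ((1 - t : ℝ) : ℂ) = 1 := by
      have := congrArg (· * z⁻¹) h
      simpa [mul_assoc, mul_inv_cancel₀ hz0] using this
    have : (1 - t : ℝ) = 1 := by exact_mod_cast this
    exact (ne_of_gt (mem_Ioi.1 ht)) (by linarith)
  have hu_tend' : Tendsto u (𝓝[>] 0) (𝓝[≠] z) :=
    tendsto_nhdsWithin_iff.2 ⟨hu_tend, hu_ne⟩
  have hmem : ∀ᶠ t in 𝓝[>] (0 : ℝ), u t ∈ A := by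
    filter_upwards [hu_tend'.eventually hev, Ioo_mem_nhdsGT (zero_lt_one' ℝ)] with t h1 h2
    refine ⟨?_, h1⟩
    rw [mem_closedBall, dist_zero_right] at hz ⊢
    rw [hu, norm_mul, Complex.norm_real, Real.norm_eq_abs,
      abs_of_nonneg (by linarith [h2.2]), sub_mul, one_mul]
    nlinarith [h2.1, norm_nonneg z]
  have hzcl : z ∈ closure A := mem_closure_of_tendsto hu_tend hmem
  have hAcl : closure A ⊆ closedBall (0 : ℂ) r :=
    closure_minimal (fun w hw => hw.1) isClosed_closedBall
  exact le_on_closure (f := fun w => ‖g w‖) (g := fun _ => ε) (fun w hw => hb w hw.1 hw.2)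
    ((hg.mono hAcl).norm) continuousOn_const hzcl

/-- `logDeriv G` is differentiable where `G` is analytic and non-zero. [folklore] -/
theorem differentiableAt_logDeriv {G : ℂ → ℂ} {z : ℂ} (hG : AnalyticAt ℂ G z) (hGz : G z ≠ 0) :
    DifferentiableAt ℂ (logDeriv G) z := by
  have : logDeriv G = fun w => deriv G w / G w := funext fun w => logDeriv_apply G w
  rw [this]
  exact hG.deriv.differentiableAt.div hG.differentiableAt hGz

/-- **Cauchy's estimate for `(G'/G)'`.** If `G` is holomorphic on `|z| ≤ R`, zero-free on
`|z| ≤ R/2`, and `|G'/G| ≤ ε` on `|z| ≤ R/8`, then `|(G'/G)'(z)| ≤ ε/(R/16)` for `|z| ≤ R/16`.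
[folklore] -/
theorem norm_deriv_logDeriv_le {G : ℂ → ℂ} {R ε : ℝ} (hR : 0 < R)
    (hG : AnalyticOnNhd ℂ G (closedBall (0 : ℂ) R)) (hG0 : ∀ z ∈ closedBall (0 : ℂ) (R / 2), G z ≠ 0)
    (hb : ∀ z ∈ closedBall (0 : ℂ) (R / 8), ‖logDeriv G z‖ ≤ ε) {z : ℂ}
    (hz : z ∈ closedBall (0 : ℂ) (R / 16)) : ‖deriv (logDeriv G) z‖ ≤ ε / (R / 16) := by
  rw [mem_closedBall, dist_zero_right] at hz
  refine Complex.norm_deriv_le_of_forall_mem_sphere_norm_le (by positivity) ?_ fun w hw => ?_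
  · apply DifferentiableOn.diffContOnCl
    rw [closure_ball z (by positivity)]
    intro w hw
    rw [mem_closedBall, dist_eq_norm] at hw
    have hw' : ‖w‖ ≤ R / 8 := by
      have := norm_le_norm_add_norm_sub' w z  -- ‖w‖ ≤ ‖z‖ + ‖w - z‖ variant
      linarith [norm_sub_rev w z, norm_add_le (w - z) z, show ‖w‖ ≤ ‖w - z‖ + ‖z‖ from by
        simpa using norm_add_le (w - z) z]
    have hwR : w ∈ closedBall (0 : ℂ) R := mem_closedBall_zero_iff.2 (by linarith)
    have hwR2 : w ∈ closedBall (0 : ℂ) (R / 2) := mem_closedBall_zero_iff.2 (by linarith)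
    exact (differentiableAt_logDeriv (hG w hwR) (hG0 w hwR2)).differentiableWithinAt
  · apply hb
    rw [mem_sphere, dist_eq_norm] at hw
    rw [mem_closedBall, dist_zero_right]
    have : ‖w‖ ≤ ‖w - z‖ + ‖z‖ := by simpa using norm_add_le (w - z) z
    linarith

/-- **Mean value:** under the same hypotheses, `|G'/G(z) − G'/G(0)| ≤ (ε/(R/16)) |z|` for
`|z| ≤ R/16`. [folklore] -/
theorem norm_logDeriv_sub_logDeriv_zero_le {G : ℂ → ℂ} {R ε : ℝ} (hR : 0 < R)
    (hG : AnalyticOnNhd ℂ G (closedBall (0 : ℂ) R)) (hG0 : ∀ z ∈ closedBall (0 : ℂ) (R / 2), G z ≠ 0)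
    (hb : ∀ z ∈ closedBall (0 : ℂ) (R / 8), ‖logDeriv G z‖ ≤ ε) {z : ℂ}
    (hz : z ∈ closedBall (0 : ℂ) (R / 16)) :
    ‖logDeriv G z - logDeriv G 0‖ ≤ ε / (R / 16) * ‖z‖ := by
  have h := Convex.norm_image_sub_le_of_norm_deriv_le (f := logDeriv G) (s := closedBall (0 : ℂ) (R / 16))
    (fun w hw => ?_) (fun w hw => norm_deriv_logDeriv_le hR hG hG0 hb hw) (convex_closedBall 0 _)
    (mem_closedBall_self (by positivity)) hz
  · simpa using h
  · rw [mem_closedBall, dist_zero_right] at hw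
    exact differentiableAt_logDeriv (hG w (mem_closedBall_zero_iff.2 (by linarith)))
      (hG0 w (mem_closedBall_zero_iff.2 (by linarith)))

/-! ### The far factor is almost an exponential near the origin -/

/-- **`G = G(0) e^{βz} e^{φ(z)}` with `φ` small.** Let `G` be holomorphic on `|z| ≤ R`, zero-free
on `|z| ≤ R/2`, with `|G'/G| ≤ ε` on `|z| ≤ R/8`, and `R ≥ 32`. Put `β = G'/G(0)`. Then there is
`φ` holomorphic on `|z| < 2` with `φ(0) = 0`, `G(z) = G(0) e^{βz} e^{φ(z)}` and
`|φ(z)| ≤ (2ε/(R/16)) |z|` for `|z| < 2` (a holomorphic logarithm of `e^{−βz} G(z)/G(0)`, whose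
logarithmic derivative `G'/G − β` is `≤ (ε/(R/16))|z|` by the mean value inequality). [folklore] -/
theorem exists_exp_repr_farFactor {G : ℂ → ℂ} {R ε : ℝ} (hR : 32 ≤ R)
    (hG : AnalyticOnNhd ℂ G (closedBall (0 : ℂ) R)) (hG0 : ∀ z ∈ closedBall (0 : ℂ) (R / 2), G z ≠ 0)
    (hb : ∀ z ∈ closedBall (0 : ℂ) (R / 8), ‖logDeriv G z‖ ≤ ε) :
    ∃ φ : ℂ → ℂ, φ 0 = 0 ∧ DifferentiableOn ℂ φ (ball (0 : ℂ) 2) ∧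
      (∀ z ∈ ball (0 : ℂ) 2, G z = G 0 * exp (logDeriv G 0 * z) * exp (φ z)) ∧
      ∀ z ∈ ball (0 : ℂ) 2, ‖φ z‖ ≤ 2 * (ε / (R / 16)) * ‖z‖ := by
  have hR0 : 0 < R := by linarith
  set β : ℂ := logDeriv G 0 with hβ
  set k : ℂ → ℂ := fun w => exp (-(β * w)) * G w with hk
  have hball : ∀ w ∈ ball (0 : ℂ) 2, w ∈ closedBall (0 : ℂ) (R / 16) := fun w hw => by
    rw [mem_ball, dist_zero_right] at hw
    exact mem_closedBall_zero_iff.2 (by linarith)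
  have hGw : ∀ w ∈ ball (0 : ℂ) 2, G w ≠ 0 := fun w hw =>
    hG0 w (closedBall_subset_closedBall (by linarith) (hball w hw))
  have hGan : ∀ w ∈ ball (0 : ℂ) 2, AnalyticAt ℂ G w := fun w hw =>
    hG w (closedBall_subset_closedBall (by linarith) (hball w hw))
  have hkd : ∀ w ∈ ball (0 : ℂ) 2, HasDerivAt k (exp (-(β * w)) * (-β) * G w +
      exp (-(β * w)) * deriv G w) w := fun w hw => by
    have h1 : HasDerivAt (fun w : ℂ => exp (-(β * w))) (exp (-(β * w)) * (-β)) w := by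
      have := ((hasDerivAt_id w).const_mul β).neg.cexp
      simpa using this
    exact h1.mul (hGan w hw).differentiableAt.hasDerivAt
  have hkdiff : DifferentiableOn ℂ k (ball (0 : ℂ) 2) := fun w hw =>
    (hkd w hw).differentiableAt.differentiableWithinAt
  have hk0 : ∀ w ∈ ball (0 : ℂ) 2, k w ≠ 0 := fun w hw =>
    mul_ne_zero (exp_ne_zero _) (hGw w hw)
  obtain ⟨φ, hφd, hφ0, hφderiv, hφrepr⟩ := exists_log_on_ball hkdiff hk0
  have hkc : k 0 = G 0 := by simp [hk]
  -- the logarithmic derivative of `k` is `G'/G - β`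
  have hφ' : ∀ w ∈ ball (0 : ℂ) 2, deriv φ w = logDeriv G w - β := fun w hw => by
    rw [(hφderiv w hw).deriv, (hkd w hw).deriv, hk]
    have hGw0 := hGw w hw
    have he : exp (-(β * w)) ≠ 0 := exp_ne_zero _
    rw [logDeriv_apply]
    field_simp
    ring
  refine ⟨φ, hφ0, hφd, fun z hz => ?_, fun z hz => ?_⟩
  · have h : exp (-(β * z)) * G z = G 0 * exp (φ z) := by
      have := hφrepr z hz
      rwa [hkc, hk] at this
    -- `exp(-βz) G z = G 0 exp(φ z)`
    have he : exp (β * z) * exp (-(β * z)) = 1 := by rw [← Complex.exp_add, add_neg_cancel, exp_zero]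
    calc G z = exp (β * z) * (exp (-(β * z)) * G z) := by rw [← mul_assoc, he, one_mul]
      _ = G 0 * exp (logDeriv G 0 * z) * exp (φ z) := by rw [h, hβ]; ring
  · -- mean value inequality for `φ` on the convex ball, using `|φ'(w)| ≤ (ε/(R/16))|w| ≤ 2ε/(R/16)`
    have hbound : ∀ w ∈ ball (0 : ℂ) 2, ‖deriv φ w‖ ≤ 2 * (ε / (R / 16)) := fun w hw => by
      rw [hφ' w hw, hβ]
      have h1 := norm_logDeriv_sub_logDeriv_zero_le hR0 hG hG0 hb (hball w hw)
      rw [mem_ball, dist_zero_right] at hw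
      have hε : 0 ≤ ε / (R / 16) := by
        have := (norm_nonneg _).trans (hb 0 (mem_closedBall_self (by positivity)))
        positivity
      calc ‖logDeriv G w - logDeriv G 0‖ ≤ ε / (R / 16) * ‖w‖ := h1
        _ ≤ ε / (R / 16) * 2 := by gcongr
        _ = 2 * (ε / (R / 16)) := by ring
    have h := Convex.norm_image_sub_le_of_norm_deriv_le (f := φ) (s := ball (0 : ℂ) 2)
      (fun w hw => (hφderiv w hw).differentiableAt) hbound (convex_ball 0 2)
      (mem_ball_self two_pos) hz
    simpa [hφ0] using h

end Literature.Analysis.Complex.KimLee
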